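import Summits.QuantumFields.BalabanUV.Beta.MultiscaleAveragingKernel
import Summits.QuantumFields.BalabanUV.Beta.MultiscaleSupRowSums
import Summits.QuantumFields.BalabanUV.Beta.MultiscaleRemainderLeibniz

/-!
# Beta / MultiscaleRemainderWRSRows — THE FOUR ROW BOUNDS OF THE PARAMETRIX REMAINDER `K(h)·P` IN THE (2.16)∕WRS CURRENCY from the INTERIOR
# row-sum members of `P` (sup: `n²`, gradient: `n`), the bump data and a K-margin (MODEL; FLAT transport for the target-side Leibniz part;
# second file of brick (c) of the (w4-d)-flat programme, claim «WRS-PARAMETRIX-FLAT» journal l.25540; unit `b2b-balaban-beta-d4-p2`, GEN 12)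

`K(h) = (leibRemT h + leibRemRT h)∘∇_U + M_{Δ_ch} + [M_h, Q]` (this lineage's `MultiscaleRemainderLeibniz.remK_eq`).  For an operator `P` with
INTERIOR members — at `Kint` rows `Σ_q|P(δ_q)(p)|e^{κ′d_n(p₁,q₁)} ≤ 𝔅_w·n(p₁)²`, at `Kint` bonds `Σ_q|(∇_U Pδ_q)(b,i)|e^{κ′d_n(b₋,q₁)} ≤ 𝔅_∇·n(b₋)`
— a bump with `|c∂h| ≤ θ₁`, `|Δ_ch| ≤ θ₂`, cell oscillation `≤ m`, a margin (`c∂h ≠ 0 ⟹ Kint b₋`, `Δ_ch ≠ 0 ⟹ Kint`, `h` non-constant on a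
cell ⟹ the cell is `Kint`) and `n ≤ Λ` on `Kint`, the weighted rows of the four parts of `K(h)·P` obey:
* **`row_leibT_le`** `≤ d·θ₁·𝔅_∇·Λ` (at most `d` bonds leave `x`; `b₋ = x` exactly);
* **`row_leibRT_le`** `≤ d·θ₁·e^{κ′}·𝔅_∇·Λ` (flat transport; the row weight moves across one bond: `d_n(b₊,·) ≤ 1 + d_n(b₋,·)`);
* **`row_lap_le`** `≤ θ₂·𝔅_w·Λ²`;
* **`row_comm_le`** `≤ 2m·e^{4dκ′}·|Cp|·a_max·𝔅_w` — on the one weighted cell through `x` the kernel `a_lω_l²τ(h(x) − h(y))`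
  (`MultiscaleAveragingKernel.comm_apply_cell`, `|τ| ≤ 1`) meets sup rows `≤ 𝔅_w·S_l²` at the cell's `≤ S_l^d` sites, and
  `a_lω_l²S_l^d ≤ a_max∕S_l²`: the scale CANCELS; `d_n ≤ 4d` inside a cell costs `e^{4dκ′}`.
For the scale-adapted cube family (`θ₁ = |c₀|K₁∕(MS_j)`, `θ₂ = c₀²dK₂∕(MS_j)²`, `m = dLK₁∕M`, `Λ = L·S_j`) every bound is `O(1∕M)`, LEVEL-FREE.

HONEST FRAMING: discharging `BetaPertH` makes Bałaban's UV stability UNCONDITIONAL — NOT the continuum limit, NOT the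
Clay problem.  HONEST DEPENDENCY (verbatim): «continuum YM on T⁴ ⇐ BetaPertH ∧ nine spine estimates (0/9 proved);
BetaPertH ⇐ (D1) ∧ (D4) ∧ CAP+tail; G-an2-4 gates asym, D1 and NE2/3/4.»  THIS MODULE DISCHARGES NOTHING of `BetaPertH`,
asserts NOTHING printed and cites nothing as a fact (ABSOLUTE RULE): [folklore] finite-dimensional bookkeeping about the pv21 component
MODEL; members, bump data and margins are DATA (hypotheses displayed in the signatures).  LOCI (shape only): [B9] =
`Balaban1985BackgroundPropagators` (3.16)/(3.19)/(3.24) pp. 393–394, (3.87)–(3.89) pp. 408–409; [B6] = `Balaban1984PropagatorsII`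
(2.38)–(2.40) pp. 229–230; [II] = `Balaban1988RG2Cluster` (2.16) p. 15.  No class change on row D4 (critical-path width 0; D4 DISCHARGE
NO DATE); NOT BetaPertH, NOT continuum, NOT Clay, NOT summit progress.
-/

open Finset

namespace Summit.QuantumFields.BalabanUV.Beta.MultiscaleRemainderWRSRows

open Summit.QuantumFields.BalabanUV.Beta.BoxPoincare (Box)
open Summit.QuantumFields.BalabanUV.Beta.MultiscaleCoerciveTorus
open Summit.QuantumFields.BalabanUV.Beta.MultiscaleDistance
open Summit.QuantumFields.BalabanUV.Beta.MultiscaleDistanceMetric (sdist_comm sdist_triangle_torus)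
open Summit.QuantumFields.BalabanUV.Beta.MultiscaleDecayBudget
open Summit.QuantumFields.BalabanUV.Beta.AccretiveCombesThomasSandwichSite (sdist_corner_thresholds)
open Summit.QuantumFields.BalabanUV.Beta.MultiscaleAveragingPointwise (abs_sum_col_mul_le block_filter_eq_cell)
open Summit.QuantumFields.BalabanUV.Beta.MultiscaleRemainderLeibniz (lapH leibRemRT leibRemRT_apply remK remK_eq)
open Literature.MathematicalPhysics.QuantumFieldTheory.Balaban1983to89
open Literature.MathematicalPhysics.QuantumFieldTheory.Balaban1983to89.B9Thm37Sum (mulOp mulOp_apply)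
open Literature.MathematicalPhysics.QuantumFieldTheory.Balaban1983to89.B9Thm37Glue (covD covD_apply leibRemT leibRemT_apply)
open Literature.MathematicalPhysics.QuantumFieldTheory.Balaban1983to89.B9Thm37GluePU (bsrc btgt bsrc_apply btgt_apply)
open Literature.MathematicalPhysics.QuantumFieldTheory.Balaban1983to89.B9Thm37GlueTorusCov (tblk)
open Literature.MathematicalPhysics.QuantumFieldTheory.Balaban1983to89.B9Thm37GlueTorusCovLevels (levelOp levelSum levelSum_apply)
open Literature.MathematicalPhysics.QuantumFieldTheory.Balaban1983to89.B9Thm37GlueTorusCovCT (card_filter_bsrc_le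
  card_filter_btgt_le)
open B5TorusCover (UT Ctr ctrU)
open Summit.QuantumFields.BalabanUV.Beta.MultiscaleAveragingKernel

noncomputable section

variable {d : ℕ} {N : Fin d → ℕ} [∀ i, NeZero (N i)] [NeZero d] {Cp J K : Type} [Fintype Cp] [DecidableEq Cp]
  [Fintype J] [Fintype K] [DecidableEq K] (S : J → ℕ) (hS : ∀ l, 1 ≤ S l) (hdivS : ∀ l i, S l ∣ N i) (lvl : K → J)
  (zc : (k : K) → Ctr N (S (lvl k)))
  (hdisj : ∀ k k' v v', cellPt S hS hdivS lvl zc k v = cellPt S hS hdivS lvl zc k' v' → k = k')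
  (hcover : ∀ x : UT N, ∃ k, ∃ v : Box d (S (lvl k)), cellPt S hS hdivS lvl zc k v = x)
  (T : J → UT N → Cp → Cp → ℝ) (a : J → ℝ) (ω : J → UT N → ℝ)

include hdisj

section Rows

variable (c : UT N × Fin d → ℝ) (Rm : UT N × Fin d → Cp → Cp → ℝ) (h : UT N → ℝ) (P : Module.End ℝ (UT N × Cp → ℝ))
  (Kint : UT N → Prop)

omit hdisj [NeZero d] [Fintype J] [Fintype K] [DecidableEq K] in
/-- **ROW BOUND (T1): the source-side Leibniz part** `(leibRemT h)∘∇_U∘P` — at most `d` bonds leave `x`, each carries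
`|c∂h| ≤ θ₁` and, when `c∂h ≠ 0`, an INTERIOR gradient row of `P` (`≤ 𝔅_∇·n(b₋)`, `n(b₋) ≤ Λ`): `≤ d·θ₁·𝔅_∇·Λ`.
[cite: Balaban1985BackgroundPropagators, (3.88)–(3.89) p.409] [folklore] -/
theorem row_leibT_le {θ₁ Λs 𝔅g κ' : ℝ} (hθ₁ : 0 ≤ θ₁) (hΛs : 0 ≤ Λs) (h𝔅g : 0 ≤ 𝔅g)
    (hdh : ∀ b, |c b * (h (btgt b) - h (bsrc b))| ≤ θ₁)
    (hKb : ∀ b, c b * (h (btgt b) - h (bsrc b)) ≠ 0 → Kint (bsrc b))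
    (hKn : ∀ x, Kint x → (siteScale S hS hdivS lvl zc hcover x : ℝ) ≤ Λs)
    (hW2 : ∀ (b : UT N × Fin d) (i : Cp), Kint (bsrc b) →
      ∑ q, |covD bsrc btgt c Rm (P (Pi.single q 1)) (b, i)| *
          Real.exp (κ' * sdist bsrc btgt (siteScale S hS hdivS lvl zc hcover) (bsrc b) q.1) ≤
        𝔅g * (siteScale S hS hdivS lvl zc hcover (bsrc b) : ℝ))
    (p : UT N × Cp) :
    ∑ q, |leibRemT bsrc btgt c h (covD bsrc btgt c Rm (P (Pi.single q 1))) p| *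
        Real.exp (κ' * sdist bsrc btgt (siteScale S hS hdivS lvl zc hcover) p.1 q.1) ≤ d * θ₁ * 𝔅g * Λs := by
  classical
  set n := siteScale S hS hdivS lvl zc hcover with hn
  set dh : UT N × Fin d → ℝ := fun b => c b * (h (btgt b) - h (bsrc b)) with hdhdef
  set g : UT N × Cp → UT N × Fin d → ℝ := fun q b => covD bsrc btgt c Rm (P (Pi.single q 1)) (b, p.2) with hg
  set E : UT N × Cp → ℝ := fun q => Real.exp (κ' * sdist bsrc btgt n p.1 q.1) with hE
  set Fb := univ.filter (fun b : UT N × Fin d => bsrc b = p.1) with hFb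
  have hpt : ∀ q, |leibRemT bsrc btgt c h (covD bsrc btgt c Rm (P (Pi.single q 1))) p| ≤ ∑ b ∈ Fb, |dh b| * |g q b| := by
    intro q
    rw [leibRemT_apply]
    exact abs_sum_ite_mul_le bsrc p.1 dh (g q)
  -- per bond
  have hb : ∀ b ∈ Fb, |dh b| * ∑ q, |g q b| * E q ≤ θ₁ * 𝔅g * Λs := by
    intro b hbF
    have hbx : bsrc b = p.1 := (mem_filter.mp hbF).2
    by_cases h0 : dh b = 0
    · rw [h0, abs_zero, zero_mul]; positivity
    · have hK : Kint (bsrc b) := hKb b h0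
      have h2 := hW2 b p.2 hK
      rw [hbx] at h2
      have hsum : ∑ q, |g q b| * E q ≤ 𝔅g * Λs :=
        h2.trans (mul_le_mul_of_nonneg_left (hKn _ (hbx ▸ hK)) h𝔅g)
      calc |dh b| * ∑ q, |g q b| * E q ≤ θ₁ * (𝔅g * Λs) :=
            mul_le_mul (hdh b) hsum (Finset.sum_nonneg fun q _ => by positivity) hθ₁
        _ = θ₁ * 𝔅g * Λs := by ring
  have hcard : (Fb.card : ℝ) ≤ d := by exact_mod_cast card_filter_bsrc_le p.1
  calc ∑ q, |leibRemT bsrc btgt c h (covD bsrc btgt c Rm (P (Pi.single q 1))) p| * E q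
      ≤ ∑ q, (∑ b ∈ Fb, |dh b| * |g q b|) * E q :=
        Finset.sum_le_sum fun q _ => mul_le_mul_of_nonneg_right (hpt q) (Real.exp_pos _).le
    _ = ∑ b ∈ Fb, |dh b| * ∑ q, |g q b| * E q := by
        simp_rw [Finset.sum_mul]
        rw [Finset.sum_comm]
        refine Finset.sum_congr rfl fun b _ => ?_
        rw [Finset.mul_sum]
        exact Finset.sum_congr rfl fun q _ => by ring
    _ ≤ ∑ b ∈ Fb, θ₁ * 𝔅g * Λs := Finset.sum_le_sum hb
    _ = (Fb.card : ℝ) * (θ₁ * 𝔅g * Λs) := by rw [Finset.sum_const, nsmul_eq_mul]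
    _ ≤ d * (θ₁ * 𝔅g * Λs) := mul_le_mul_of_nonneg_right hcard (by positivity)
    _ = d * θ₁ * 𝔅g * Λs := by ring

omit hdisj [NeZero d] [Fintype J] [Fintype K] [DecidableEq K] in
/-- **ROW BOUND (T2): the target-side Leibniz part** `(leibRemRT h)∘∇_U∘P` (FLAT transport) — at most `d` bonds enter `x`; the
row weight at `x = b₊` is converted to the one at `b₋` at the price `e^{κ′}` (`d_n(b₊,·) ≤ 1 + d_n(b₋,·)`): `≤ d·θ₁·e^{κ′}·𝔅_∇·Λ`.
[cite: Balaban1985BackgroundPropagators, (3.88)–(3.89) p.409] [folklore] -/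
theorem row_leibRT_le (hflat : ∀ b k i, Rm b k i = if k = i then 1 else 0)
    {θ₁ Λs 𝔅g κ' : ℝ} (hθ₁ : 0 ≤ θ₁) (hΛs : 0 ≤ Λs) (h𝔅g : 0 ≤ 𝔅g) (hκ' : 0 ≤ κ')
    (hdh : ∀ b, |c b * (h (btgt b) - h (bsrc b))| ≤ θ₁)
    (hKb : ∀ b, c b * (h (btgt b) - h (bsrc b)) ≠ 0 → Kint (bsrc b))
    (hKn : ∀ x, Kint x → (siteScale S hS hdivS lvl zc hcover x : ℝ) ≤ Λs)
    (hW2 : ∀ (b : UT N × Fin d) (i : Cp), Kint (bsrc b) →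
      ∑ q, |covD bsrc btgt c Rm (P (Pi.single q 1)) (b, i)| *
          Real.exp (κ' * sdist bsrc btgt (siteScale S hS hdivS lvl zc hcover) (bsrc b) q.1) ≤
        𝔅g * (siteScale S hS hdivS lvl zc hcover (bsrc b) : ℝ))
    (p : UT N × Cp) :
    ∑ q, |leibRemRT bsrc btgt c Rm h (covD bsrc btgt c Rm (P (Pi.single q 1))) p| *
        Real.exp (κ' * sdist bsrc btgt (siteScale S hS hdivS lvl zc hcover) p.1 q.1) ≤
      d * θ₁ * Real.exp κ' * 𝔅g * Λs := by
  classical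
  set n := siteScale S hS hdivS lvl zc hcover with hn
  set dh : UT N × Fin d → ℝ := fun b => c b * (h (btgt b) - h (bsrc b)) with hdhdef
  set g : UT N × Cp → UT N × Fin d → ℝ := fun q b => covD bsrc btgt c Rm (P (Pi.single q 1)) (b, p.2) with hg
  set E : UT N × Cp → ℝ := fun q => Real.exp (κ' * sdist bsrc btgt n p.1 q.1) with hE
  set Fb := univ.filter (fun b : UT N × Fin d => btgt b = p.1) with hFb
  -- flat transport: `Σ_k R_{ki} g(b,k) = g(b,i)`
  have hflat' : ∀ (b : UT N × Fin d) (G : (UT N × Fin d) × Cp → ℝ), ∑ k, Rm b k p.2 * G (b, k) = G (b, p.2) := by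
    intro b G
    simp only [hflat, ite_mul, one_mul, zero_mul, Finset.sum_ite_eq', Finset.mem_univ, if_true]
  have hpt : ∀ q, |leibRemRT bsrc btgt c Rm h (covD bsrc btgt c Rm (P (Pi.single q 1))) p| ≤ ∑ b ∈ Fb, |dh b| * |g q b| := by
    intro q
    rw [leibRemRT_apply]
    simp_rw [hflat']
    exact abs_sum_ite_mul_le btgt p.1 dh (g q)
  -- the weight shift across one bond
  have hn1 : ∀ y, 1 ≤ n y := fun y => one_le_siteScale S hS hdivS lvl zc hcover y
  have hshift : ∀ b ∈ Fb, ∀ q, E q ≤ Real.exp κ' * Real.exp (κ' * sdist bsrc btgt n (bsrc b) q.1) := by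
    intro b hbF q
    have hbx : btgt b = p.1 := (mem_filter.mp hbF).2
    rw [← Real.exp_add, hE]
    refine Real.exp_le_exp.mpr ?_
    have h1 := sdist_tgt_le bsrc btgt n b q.1
    have h2 := slen_le_one n hn1 (bsrc b) (btgt b)
    rw [hbx] at h1 h2
    have h3 : sdist bsrc btgt n p.1 q.1 ≤ 1 + sdist bsrc btgt n (bsrc b) q.1 := by linarith
    have h4 := mul_le_mul_of_nonneg_left h3 hκ'
    linarith
  -- per bond
  have hb : ∀ b ∈ Fb, |dh b| * ∑ q, |g q b| * E q ≤ θ₁ * (Real.exp κ' * 𝔅g * Λs) := by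
    intro b hbF
    by_cases h0 : dh b = 0
    · rw [h0, abs_zero, zero_mul]; positivity
    · have hK : Kint (bsrc b) := hKb b h0
      have h2 := hW2 b p.2 hK
      have hsum : ∑ q, |g q b| * E q ≤ Real.exp κ' * 𝔅g * Λs := by
        calc ∑ q, |g q b| * E q ≤ ∑ q, |g q b| * (Real.exp κ' * Real.exp (κ' * sdist bsrc btgt n (bsrc b) q.1)) :=
              Finset.sum_le_sum fun q _ => mul_le_mul_of_nonneg_left (hshift b hbF q) (abs_nonneg _)
          _ = Real.exp κ' * ∑ q, |g q b| * Real.exp (κ' * sdist bsrc btgt n (bsrc b) q.1) := by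
              rw [Finset.mul_sum]; exact Finset.sum_congr rfl fun q _ => by ring
          _ ≤ Real.exp κ' * (𝔅g * Λs) :=
              mul_le_mul_of_nonneg_left (h2.trans (mul_le_mul_of_nonneg_left (hKn _ hK) h𝔅g)) (Real.exp_pos _).le
          _ = Real.exp κ' * 𝔅g * Λs := by ring
      exact mul_le_mul (hdh b) hsum (Finset.sum_nonneg fun q _ => by positivity) hθ₁
  have hcard : (Fb.card : ℝ) ≤ d := by exact_mod_cast card_filter_btgt_le p.1
  calc ∑ q, |leibRemRT bsrc btgt c Rm h (covD bsrc btgt c Rm (P (Pi.single q 1))) p| * E q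
      ≤ ∑ q, (∑ b ∈ Fb, |dh b| * |g q b|) * E q :=
        Finset.sum_le_sum fun q _ => mul_le_mul_of_nonneg_right (hpt q) (Real.exp_pos _).le
    _ = ∑ b ∈ Fb, |dh b| * ∑ q, |g q b| * E q := by
        simp_rw [Finset.sum_mul]
        rw [Finset.sum_comm]
        refine Finset.sum_congr rfl fun b _ => ?_
        rw [Finset.mul_sum]
        exact Finset.sum_congr rfl fun q _ => by ring
    _ ≤ ∑ b ∈ Fb, θ₁ * (Real.exp κ' * 𝔅g * Λs) := Finset.sum_le_sum hb
    _ = (Fb.card : ℝ) * (θ₁ * (Real.exp κ' * 𝔅g * Λs)) := by rw [Finset.sum_const, nsmul_eq_mul]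
    _ ≤ d * (θ₁ * (Real.exp κ' * 𝔅g * Λs)) := mul_le_mul_of_nonneg_right hcard (by positivity)
    _ = d * θ₁ * Real.exp κ' * 𝔅g * Λs := by ring

omit hdisj [NeZero d] [Fintype J] [Fintype K] [DecidableEq K] in
/-- **ROW BOUND (T3): the second-difference part** `M_{Δ_ch}∘P` — `|Δ_ch(x)| ≤ θ₂` against an INTERIOR sup row of `P`
(`≤ 𝔅_w·n(x)²`, `n(x) ≤ Λ`): `≤ θ₂·𝔅_w·Λ²`. [cite: Balaban1985BackgroundPropagators, (3.88)–(3.89) p.409] [folklore] -/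
theorem row_lap_le {θ₂ Λs 𝔅w κ' : ℝ} (hθ₂ : 0 ≤ θ₂) (h𝔅w : 0 ≤ 𝔅w)
    (hlap : ∀ x, |lapH bsrc btgt c h x| ≤ θ₂) (hKl : ∀ x, lapH bsrc btgt c h x ≠ 0 → Kint x)
    (hKn : ∀ x, Kint x → (siteScale S hS hdivS lvl zc hcover x : ℝ) ≤ Λs)
    (hW1 : ∀ p : UT N × Cp, Kint p.1 →
      ∑ q, |P (Pi.single q 1) p| * Real.exp (κ' * sdist bsrc btgt (siteScale S hS hdivS lvl zc hcover) p.1 q.1) ≤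
        𝔅w * (siteScale S hS hdivS lvl zc hcover p.1 : ℝ) ^ 2)
    (p : UT N × Cp) :
    ∑ q, |lapH bsrc btgt c h p.1 * P (Pi.single q 1) p| *
        Real.exp (κ' * sdist bsrc btgt (siteScale S hS hdivS lvl zc hcover) p.1 q.1) ≤ θ₂ * 𝔅w * Λs ^ 2 := by
  by_cases h0 : lapH bsrc btgt c h p.1 = 0
  · simp only [h0, zero_mul, abs_zero, Finset.sum_const_zero]
    positivity
  · have hK := hKl p.1 h0
    have hn : (siteScale S hS hdivS lvl zc hcover p.1 : ℝ) ^ 2 ≤ Λs ^ 2 :=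
      pow_le_pow_left₀ (Nat.cast_nonneg _) (hKn p.1 hK) 2
    calc ∑ q, |lapH bsrc btgt c h p.1 * P (Pi.single q 1) p| *
          Real.exp (κ' * sdist bsrc btgt (siteScale S hS hdivS lvl zc hcover) p.1 q.1)
        = |lapH bsrc btgt c h p.1| * ∑ q, |P (Pi.single q 1) p| *
            Real.exp (κ' * sdist bsrc btgt (siteScale S hS hdivS lvl zc hcover) p.1 q.1) := by
          rw [Finset.mul_sum]
          exact Finset.sum_congr rfl fun q _ => by rw [abs_mul]; ring
      _ ≤ θ₂ * (𝔅w * Λs ^ 2) :=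
          mul_le_mul (hlap p.1) ((hW1 p hK).trans (mul_le_mul_of_nonneg_left hn h𝔅w))
            (Finset.sum_nonneg fun q _ => by positivity) hθ₂
      _ = θ₂ * 𝔅w * Λs ^ 2 := by ring

omit [Fintype K] in
/-- **ROW BOUND (T4): the averaging commutator** `[M_h, Q]∘P` — on the ONE weighted cell through `x` (level `l`, `n ≡ S_l` there):
kernel `a_lω_l²·τ·(h(x) − h(y))` with `|τ| ≤ 1`, `|h(x) − h(y)| ≤ 2m`, `d_n(x,y) ≤ 4d`, against INTERIOR sup rows of `P` at the cell's
sites (`≤ 𝔅_w·S_l²`); the cell has `≤ S_l^d` sites and `a_lω_l²S_l^d ≤ a_max∕S_l²` — the scale CANCELS: `≤ 2m·e^{4dκ′}·|Cp|·a_max·𝔅_w`.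
[cite: Balaban1985BackgroundPropagators, (3.88)–(3.89) p.409 + (3.24) p.394; Balaban1984PropagatorsII, (2.40) p.230] [folklore] -/
theorem row_comm_le
    (hT : ∀ l x i i', ∑ k, T l x k i * T l x k i' = if i = i' then (1 : ℝ) else 0) (ha : ∀ j, 0 ≤ a j)
    (hsupp : ∀ l x, ω l (ctrU N (S l) (tblk (hS l) (hdivS l) x)) ≠ 0 → ∃ k v, lvl k = l ∧ cellPt S hS hdivS lvl zc k v = x)
    {amax : ℝ}
    (hscale : ∀ k, a (lvl k) * ω (lvl k) (ctrU N (S (lvl k)) (zc k)) ^ 2 * (S (lvl k) : ℝ) ^ d ≤ amax / (S (lvl k) : ℝ) ^ 2)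
    {m 𝔅w κ' : ℝ} (hm : 0 ≤ m) (h𝔅w : 0 ≤ 𝔅w) (hκ' : 0 ≤ κ')
    (hosc : ∀ k v, |h (cellPt S hS hdivS lvl zc k v) - h (ctrU N (S (lvl k)) (zc k))| ≤ m)
    (hKc : ∀ k v, h (cellPt S hS hdivS lvl zc k v) ≠ h (ctrU N (S (lvl k)) (zc k)) → ∀ w, Kint (cellPt S hS hdivS lvl zc k w))
    (hW1 : ∀ p : UT N × Cp, Kint p.1 →
      ∑ q, |P (Pi.single q 1) p| * Real.exp (κ' * sdist bsrc btgt (siteScale S hS hdivS lvl zc hcover) p.1 q.1) ≤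
        𝔅w * (siteScale S hS hdivS lvl zc hcover p.1 : ℝ) ^ 2)
    (p : UT N × Cp) :
    ∑ q, |h p.1 * levelSum (fun l x => ctrU N (S l) (tblk (hS l) (hdivS l) x))
          (fun l x => ω l (ctrU N (S l) (tblk (hS l) (hdivS l) x))) T a (P (Pi.single q 1)) p -
        levelSum (fun l x => ctrU N (S l) (tblk (hS l) (hdivS l) x))
          (fun l x => ω l (ctrU N (S l) (tblk (hS l) (hdivS l) x))) T a (mulOp (h ∘ Prod.fst) (P (Pi.single q 1))) p| *
        Real.exp (κ' * sdist bsrc btgt (siteScale S hS hdivS lvl zc hcover) p.1 q.1) ≤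
      2 * m * Real.exp (4 * d * κ') * Fintype.card Cp * amax * 𝔅w := by
  classical
  obtain ⟨x, i⟩ := p
  set n := siteScale S hS hdivS lvl zc hcover with hn
  set k := cellOf S hS hdivS lvl zc hcover x with hkdef
  have hk : cellOf S hS hdivS lvl zc hcover x = k := rfl
  set β : UT N := ctrU N (S (lvl k)) (zc k) with hβ
  set A : ℝ := a (lvl k) * ω (lvl k) β ^ 2 with hA
  set Fl := univ.filter (fun y : UT N => ctrU N (S (lvl k)) (tblk (hS (lvl k)) (hdivS (lvl k)) y) = β) with hFl
  set E : UT N × Cp → ℝ := fun q => Real.exp (κ' * sdist bsrc btgt n x q.1) with hE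
  have hA0 : 0 ≤ A := mul_nonneg (ha _) (sq_nonneg _)
  have hSl : (0 : ℝ) < (S (lvl k) : ℝ) := by exact_mod_cast hS (lvl k)
  -- the cell as a set of chart points
  have hFcell : Fl = univ.filter (fun y : UT N => cellOf S hS hdivS lvl zc hcover y = k) :=
    block_filter_eq_cell S hS hdivS lvl zc hdisj hcover k
  have hmemk : ∀ y ∈ Fl, cellOf S hS hdivS lvl zc hcover y = k := fun y hy => by
    rw [hFcell] at hy; exact (mem_filter.mp hy).2
  -- chart points of the cell
  have hpt_of_mem : ∀ y ∈ Fl, ∃ w : Box d (S (lvl k)), cellPt S hS hdivS lvl zc k w = y := by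
    intro y hy
    have hyβ : ctrU N (S (lvl k)) (tblk (hS (lvl k)) (hdivS (lvl k)) y) = ctrU N (S (lvl k)) (zc k) := (mem_filter.mp hy).2
    obtain ⟨w, hw⟩ := (tblk_eq_iff (hS (lvl k)) (hdivS (lvl k)) y (zc k)).mp (ctrU_injective (hS (lvl k)) hyβ)
    exact ⟨w, hw⟩
  have hxmem : x ∈ Fl := by
    rw [hFcell]; exact mem_filter.mpr ⟨mem_univ _, hk⟩
  obtain ⟨v, hv⟩ := hpt_of_mem x hxmem
  -- the commutator, explicitly
  have hcomm : ∀ q, h x * levelSum (fun l x => ctrU N (S l) (tblk (hS l) (hdivS l) x))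
        (fun l x => ω l (ctrU N (S l) (tblk (hS l) (hdivS l) x))) T a (P (Pi.single q 1)) (x, i) -
      levelSum (fun l x => ctrU N (S l) (tblk (hS l) (hdivS l) x))
        (fun l x => ω l (ctrU N (S l) (tblk (hS l) (hdivS l) x))) T a (mulOp (h ∘ Prod.fst) (P (Pi.single q 1))) (x, i) =
      A * ∑ y ∈ Fl, ∑ j, (∑ i', T (lvl k) x i' i * T (lvl k) y i' j) * ((h x - h y) * P (Pi.single q 1) (y, j)) :=
    fun q => comm_apply_cell S hS hdivS lvl zc hdisj hcover T a ω hsupp h (P (Pi.single q 1)) x i k hk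
  -- per cell site: oscillation, interiority, scale, distance
  have hy_osc : ∀ y ∈ Fl, |h x - h y| ≤ 2 * m := by
    intro y hy
    obtain ⟨w, hw⟩ := hpt_of_mem y hy
    have h1 := hosc k v
    have h2 := hosc k w
    rw [hv] at h1
    rw [hw] at h2
    calc |h x - h y| = |(h x - h β) - (h y - h β)| := by ring_nf
      _ ≤ |h x - h β| + |h y - h β| := abs_sub _ _
      _ ≤ m + m := add_le_add h1 h2
      _ = 2 * m := by ring
  have hy_int : ∀ y ∈ Fl, h x ≠ h y → Kint y := by
    intro y hy hne
    obtain ⟨w, hw⟩ := hpt_of_mem y hy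
    by_cases hxc : h x = h β
    · have hyc : h (cellPt S hS hdivS lvl zc k w) ≠ h (ctrU N (S (lvl k)) (zc k)) := by
        rw [hw, ← hβ, ← hxc]; exact fun e => hne e.symm
      rw [← hw]; exact hKc k w hyc w
    · have hxc' : h (cellPt S hS hdivS lvl zc k v) ≠ h (ctrU N (S (lvl k)) (zc k)) := by rw [hv]; exact hxc
      rw [← hw]; exact hKc k v hxc' w
  have hy_scale : ∀ y ∈ Fl, (n y : ℝ) = S (lvl k) := by
    intro y hy
    rw [hn, siteScale, hmemk y hy]
  have hy_dist : ∀ y ∈ Fl, sdist bsrc btgt n x y ≤ 4 * d := by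
    intro y hy
    have h1 := (sdist_corner_thresholds S hS hdivS lvl zc hdisj hcover x k).1 hk
    have h2 := (sdist_corner_thresholds S hS hdivS lvl zc hdisj hcover y k).1 (hmemk y hy)
    rw [← hn] at h1 h2
    rw [sdist_comm bsrc btgt n y] at h2
    have htri := sdist_triangle_torus n x β y
    linarith
  -- per cell site: the weighted row of the commutator kernel
  have hsite : ∀ y ∈ Fl, ∀ j, |h x - h y| * ∑ q, |P (Pi.single q 1) (y, j)| * E q ≤
      2 * m * (Real.exp (4 * d * κ') * (𝔅w * (S (lvl k) : ℝ) ^ 2)) := by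
    intro y hy j
    by_cases hne : h x = h y
    · rw [hne, sub_self, abs_zero, zero_mul]; positivity
    · have hK := hy_int y hy hne
      have hW := hW1 (y, j) hK
      simp only at hW
      rw [hy_scale y hy] at hW
      have hrow : ∑ q, |P (Pi.single q 1) (y, j)| * E q ≤ Real.exp (4 * d * κ') * (𝔅w * (S (lvl k) : ℝ) ^ 2) := by
        calc ∑ q, |P (Pi.single q 1) (y, j)| * E q
            ≤ ∑ q, |P (Pi.single q 1) (y, j)| * (Real.exp (4 * d * κ') * Real.exp (κ' * sdist bsrc btgt n y q.1)) := by
              refine Finset.sum_le_sum fun q _ => mul_le_mul_of_nonneg_left ?_ (abs_nonneg _)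
              rw [hE, ← Real.exp_add]
              refine Real.exp_le_exp.mpr ?_
              have htri := sdist_triangle_torus n x y q.1
              nlinarith [hy_dist y hy]
          _ = Real.exp (4 * d * κ') * ∑ q, |P (Pi.single q 1) (y, j)| * Real.exp (κ' * sdist bsrc btgt n y q.1) := by
              rw [Finset.mul_sum]; exact Finset.sum_congr rfl fun q _ => by ring
          _ ≤ Real.exp (4 * d * κ') * (𝔅w * (S (lvl k) : ℝ) ^ 2) := mul_le_mul_of_nonneg_left hW (Real.exp_pos _).le
      exact mul_le_mul (hy_osc y hy) hrow (Finset.sum_nonneg fun q _ => by positivity) (by positivity)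
  -- the cell count and the print-size weight
  have hcard : (Fl.card : ℝ) ≤ (S (lvl k) : ℝ) ^ d := by
    have := card_block_le (hS (lvl k)) (hdivS (lvl k)) β
    rw [← hFl] at this
    exact_mod_cast this
  have hAw : A * ((S (lvl k) : ℝ) ^ d * (S (lvl k) : ℝ) ^ 2) ≤ amax := by
    have h1 := hscale k
    rw [← hβ, ← hA, le_div_iff₀ (pow_pos hSl 2)] at h1
    linarith
  -- assemble
  calc ∑ q, |h x * levelSum (fun l x => ctrU N (S l) (tblk (hS l) (hdivS l) x))
            (fun l x => ω l (ctrU N (S l) (tblk (hS l) (hdivS l) x))) T a (P (Pi.single q 1)) (x, i) -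
          levelSum (fun l x => ctrU N (S l) (tblk (hS l) (hdivS l) x))
            (fun l x => ω l (ctrU N (S l) (tblk (hS l) (hdivS l) x))) T a (mulOp (h ∘ Prod.fst) (P (Pi.single q 1))) (x, i)| *
          E q
      = ∑ q, |A * ∑ y ∈ Fl, ∑ j, (∑ i', T (lvl k) x i' i * T (lvl k) y i' j) * ((h x - h y) * P (Pi.single q 1) (y, j))| * E q :=
        Finset.sum_congr rfl fun q _ => by rw [hcomm q]
    _ ≤ ∑ q, (A * ∑ y ∈ Fl, ∑ j, |h x - h y| * |P (Pi.single q 1) (y, j)|) * E q := by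
        refine Finset.sum_le_sum fun q _ => mul_le_mul_of_nonneg_right ?_ (Real.exp_pos _).le
        rw [abs_mul, abs_of_nonneg hA0]
        refine mul_le_mul_of_nonneg_left ((Finset.abs_sum_le_sum_abs _ _).trans (Finset.sum_le_sum fun y _ =>
          (Finset.abs_sum_le_sum_abs _ _).trans (Finset.sum_le_sum fun j _ => ?_))) hA0
        rw [abs_mul, abs_mul]
        calc |∑ i', T (lvl k) x i' i * T (lvl k) y i' j| * (|h x - h y| * |P (Pi.single q 1) (y, j)|)
            ≤ 1 * (|h x - h y| * |P (Pi.single q 1) (y, j)|) :=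
              mul_le_mul_of_nonneg_right (abs_transport_coeff_le_one T hT (lvl k) x y i j) (by positivity)
          _ = |h x - h y| * |P (Pi.single q 1) (y, j)| := one_mul _
    _ = A * ∑ q, (∑ y ∈ Fl, ∑ j, |h x - h y| * |P (Pi.single q 1) (y, j)|) * E q := by
        rw [Finset.mul_sum]; exact Finset.sum_congr rfl fun q _ => by ring
    _ = A * ∑ y ∈ Fl, ∑ j, |h x - h y| * ∑ q, |P (Pi.single q 1) (y, j)| * E q := by
        congr 1
        calc ∑ q, (∑ y ∈ Fl, ∑ j, |h x - h y| * |P (Pi.single q 1) (y, j)|) * E q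
            = ∑ q, ∑ y ∈ Fl, ∑ j, |h x - h y| * (|P (Pi.single q 1) (y, j)| * E q) := by
              refine Finset.sum_congr rfl fun q _ => ?_
              rw [Finset.sum_mul]
              refine Finset.sum_congr rfl fun y _ => ?_
              rw [Finset.sum_mul]
              exact Finset.sum_congr rfl fun j _ => by ring
          _ = ∑ y ∈ Fl, ∑ j, ∑ q, |h x - h y| * (|P (Pi.single q 1) (y, j)| * E q) := by
              rw [Finset.sum_comm]; exact Finset.sum_congr rfl fun y _ => Finset.sum_comm
          _ = ∑ y ∈ Fl, ∑ j, |h x - h y| * ∑ q, |P (Pi.single q 1) (y, j)| * E q := by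
              refine Finset.sum_congr rfl fun y _ => Finset.sum_congr rfl fun j _ => ?_
              rw [Finset.mul_sum]
    _ ≤ A * ∑ y ∈ Fl, ∑ j : Cp, 2 * m * (Real.exp (4 * d * κ') * (𝔅w * (S (lvl k) : ℝ) ^ 2)) :=
        mul_le_mul_of_nonneg_left (Finset.sum_le_sum fun y hy => Finset.sum_le_sum fun j _ => hsite y hy j) hA0
    _ = A * ((Fl.card : ℝ) * (Fintype.card Cp * (2 * m * (Real.exp (4 * d * κ') * (𝔅w * (S (lvl k) : ℝ) ^ 2))))) := by
        rw [Finset.sum_const, nsmul_eq_mul, Finset.sum_const, nsmul_eq_mul, Finset.card_univ]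
    _ ≤ A * ((S (lvl k) : ℝ) ^ d * (Fintype.card Cp * (2 * m * (Real.exp (4 * d * κ') * (𝔅w * (S (lvl k) : ℝ) ^ 2))))) :=
        mul_le_mul_of_nonneg_left (mul_le_mul_of_nonneg_right hcard (by positivity)) hA0
    _ = A * ((S (lvl k) : ℝ) ^ d * (S (lvl k) : ℝ) ^ 2) * (2 * m * Real.exp (4 * d * κ') * Fintype.card Cp * 𝔅w) := by ring
    _ ≤ amax * (2 * m * Real.exp (4 * d * κ') * Fintype.card Cp * 𝔅w) := mul_le_mul_of_nonneg_right hAw (by positivity)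
    _ = 2 * m * Real.exp (4 * d * κ') * Fintype.card Cp * amax * 𝔅w := by ring

end Rows

end

end Summit.QuantumFields.BalabanUV.Beta.MultiscaleRemainderWRSRows
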